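import Literature.NumberTheory.Li1992.RallisLocalFactorNonsplitPlace
import Literature.NumberTheory.Automorphic.Liu2021.Def411WeilCarriersSurvivalNonsplit
import Mathlib.Analysis.SpecificLimits.Normed
import Mathlib.Topology.Algebra.InfiniteSum.NatInt
import HarnessLib

/-!
# [Li1992, Thm 2.1 (27)] — the local factor at a SPLIT place with UNRAMIFIED data: the Tate-type sum over the cosets of
# `U(J₁)(𝒪_v)` in `U(J₁)(F_v) ≅ F_vˣ`, from the spherical matrix coefficients

J.-S. Li, J. reine angew. Math. **428** (1992), Thm 2.1 (27) p. 184 (Euler factorisation of Rallis' inner product formula) and §5 p. 206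
(the unramified local integrals); J. Tate, in Cassels–Fröhlich (1967), §3.2 (local integrals over `F_vˣ` as sums over `ϖ^m 𝒪ˣ`).
At a place `v` of `F` SPLIT in `E`, the rank-one member `U(J₁)(F_v) = E_v¹ ≅ F_vˣ` of the pair `(U(J), U(J₁))` is NOT compact: it is the
disjoint union of the cosets `z₀^m U(J₁)(𝒪_v)`, `m ∈ ℤ`, of its (compact, open) integral subgroup, for a local generator `z₀` (valuation `±1`
at the place `w ∣ v`).  With unramified data — the spherical vector `1_{𝒪_vᴺ}` fixed by `U(J₁)(𝒪_v)` through the centre and `χ_v` trivial on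
`U(J₁)(𝒪_v)` — the local factor of (27) is the TATE-TYPE SUM `vol(U(J₁)(𝒪_v)) · Σ_{m ∈ ℤ} ⟨ω_v(z₀^m · 1) 1_{𝒪ᴺ}, 1_{𝒪ᴺ}⟩ · conj χ_v(z₀)^m`.
THIS FILE proves that bookkeeping (kernel) and evaluates the sum from the SPHERICAL MATRIX COEFFICIENTS
`⟨ω_v(z₀^m · 1) 1_{𝒪ᴺ}, 1_{𝒪ᴺ}⟩ = C · u^m · r^{|m|}` (`|u| = 1`, `0 ≤ r < 1`; for the Weil representation `r = q_v^{-N/2}`, `C = μ_X(𝒪_vᴺ)`, by the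
Darboux-conjugate-torus description of the spherical vectors ★ `HeisenbergGroup/SchrodingerConjugateTorusSpherical`,
`FinLocalSplittingsSplitSpherical` — that evaluation is the input `hcoef` here, NOT proved in this file):

* §1 `hasSum_int_geometric_unit` (kernel): for `|w| = 1`, `0 ≤ r < 1`, `Σ_{m∈ℤ} w^m r^{|m|} = (1 − r²) ∕ |1 − w r|²` — a POSITIVE real
  (`int_geometric_unit_pos`), `= 1 + O(r)`; `summable_pow_natAbs`.
* §2 `integral_eq_of_cosets` (kernel, any topological group): if `K` is an open subgroup of finite measure for a left-invariant `μ`, `G = ⊔_m z₀^m K`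
  (`hcover`, `hfree`) and `f` is right-`K`-invariant with `Σ_m ‖f(z₀^m)‖ < ∞`, then `f` is integrable and `∫_G f dμ = μ(K) · Σ_m f(z₀^m)`.
* §3 **`FinLocalSplittings.hasSum_localFactor_unitVec_of_sphericalCoeff`** / **`…_ne_zero`**: at a place `v` with such a generator `z₀` of
  `U(J₁)(F_v) ∕ U(J₁)(𝒪_v)`, if `U(J₁)(𝒪_v)` fixes `1_{𝒪_vᴺ}` through the centre (★ `𝓢.unramified` + `localCenter_mapsTo_localInt`, almost every
  `v`), `χ_v` is trivial on `U(J₁)(𝒪_v)` (★ `eventually_localCharOfCenter_eq_one`) and unitary at `z₀`, and the spherical matrix coefficients are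
  `C u^m r^{|m|}`, then `∫_{U(J₁)(F_v)} ⟨ω_v(h·1)1_{𝒪ᴺ}, 1_{𝒪ᴺ}⟩ conj χ_v(h) dh = dh(U(J₁)(𝒪_v)) · C · (1 − r²) ∕ |1 − u conj χ_v(z₀) r|²`, non-zero when
  `C ≠ 0` — the split unramified clause (F4) of the finite half of the cell's S4′(ii) assembly (`F0/P4/SEAT-ii-MEMO-S4ii.v1`), modulo `hcoef`.

KERNEL only: theorems, no definition, no named fact, no `sorry`.  Cell hodgecm-mathlib, FLOOR 0, programme P4, crux item H413
(`--supports stmt-HodgeConjecture-24833`).  HC_CM is proved only modulo the printed citations until rung 0 closes; nothing here is a claim about them.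

## References
* [Li1992] J.-S. Li, J. reine angew. Math. 428 (1992) 177–217 — Thm 2.1 (27) p. 184; §5 p. 206.
* [TateThesis1967] J. Tate, in Cassels–Fröhlich, *Algebraic Number Theory* (1967), Ch. XV §3.2, §4.2 (local zeta integrals as sums over `ϖ^m 𝒪ˣ`).
* [GelbartRogawski1991] S. Gelbart, J. Rogawski, Invent. Math. 105 (1991), §3.1 (3.1.3) p. 456, §3.2.
-/

set_option autoImplicit false

noncomputable section

open NumberField IsDedekindDomain MeasureTheory Filter Set
open scoped Matrix NNReal Topology ComplexConjugate
open Literature.RepresentationTheory Literature.RepresentationTheory.HeisenbergGroup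
open Literature.NumberTheory.Automorphic
open Literature.NumberTheory.Automorphic.UnitaryGroup
open Literature.NumberTheory.Automorphic.Liu2021
open Literature.NumberTheory.Weil1964

namespace Literature.NumberTheory.Li1992

/-! ## §1 The two-sided geometric sum `Σ_{m∈ℤ} w^m r^{|m|}` -/

section Geometric

/-- `Σ_{m∈ℤ} r^{|m|}` converges for `0 ≤ r < 1`. [cite: TateThesis1967, §4.2] -/
theorem summable_pow_natAbs {r : ℝ} (hr0 : 0 ≤ r) (hr1 : r < 1) : Summable fun m : ℤ => r ^ m.natAbs := by
  refine Summable.of_nat_of_neg_add_one ?_ ?_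
  · simpa only [Int.natAbs_natCast] using summable_geometric_of_lt_one hr0 hr1
  · have h : Summable fun n : ℕ => r * r ^ n := (summable_geometric_of_lt_one hr0 hr1).mul_left r
    refine h.congr fun n => ?_
    rw [show (-(n + 1 : ℤ)).natAbs = n + 1 by omega, pow_succ, mul_comm]

/-- **`Σ_{m∈ℤ} w^m r^{|m|} = (1 − r²) ∕ |1 − w r|²` for `|w| = 1`, `0 ≤ r < 1`** (the two geometric series `Σ_{m≥0} (wr)^m` and
`Σ_{m≥1} (w̄r)^m`; `w⁻¹ = w̄`). [cite: TateThesis1967, §4.2] -/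
theorem hasSum_int_geometric_unit {w : ℂ} (hw : ‖w‖ = 1) {r : ℝ} (hr0 : 0 ≤ r) (hr1 : r < 1) :
    HasSum (fun m : ℤ => w ^ m * (r : ℂ) ^ m.natAbs) (((1 - r ^ 2) / ‖1 - w * r‖ ^ 2 : ℝ) : ℂ) := by
  have hw0 : w ≠ 0 := fun h => by simp [h] at hw
  have ha : ‖w * r‖ < 1 := by
    rw [norm_mul, hw, one_mul, Complex.norm_real, Real.norm_eq_abs, abs_of_nonneg hr0]; exact hr1
  have hb : ‖w⁻¹ * r‖ < 1 := by
    rw [norm_mul, norm_inv, hw, inv_one, one_mul, Complex.norm_real, Real.norm_eq_abs, abs_of_nonneg hr0]; exact hr1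
  have h₁ : HasSum (fun n : ℕ => w ^ (n : ℤ) * (r : ℂ) ^ (n : ℤ).natAbs) (1 - w * r)⁻¹ := by
    refine (hasSum_geometric_of_norm_lt_one ha).congr_fun fun n => ?_
    rw [Int.natAbs_natCast, zpow_natCast, mul_pow]
  have h₂ : HasSum (fun n : ℕ => w ^ (-(n + 1 : ℤ)) * (r : ℂ) ^ (-(n + 1 : ℤ)).natAbs) ((w⁻¹ * r) * (1 - w⁻¹ * r)⁻¹) := by
    refine ((hasSum_geometric_of_norm_lt_one hb).mul_left (w⁻¹ * r)).congr_fun fun n => ?_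
    rw [show (-(n + 1 : ℤ)).natAbs = n + 1 by omega, zpow_neg, show ((n : ℤ) + 1) = ((n + 1 : ℕ) : ℤ) by push_cast; ring,
      zpow_natCast, ← pow_succ', mul_pow, inv_pow]
  have h := HasSum.of_nat_of_neg_add_one (f := fun m : ℤ => w ^ m * (r : ℂ) ^ m.natAbs) h₁ h₂
  convert h using 1
  -- the value: `(1 − wr)⁻¹ + w̄r (1 − w̄r)⁻¹ = (1 − r²)/((1 − wr)(1 − w̄r)) = (1 − r²)/|1 − wr|²`
  have hne₁ : (1 - w * r : ℂ) ≠ 0 := fun h0 => by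
    have : ‖w * (r : ℂ)‖ = 1 := by rw [← sub_eq_zero.1 h0, norm_one]
    exact ha.ne this
  have hne₂ : (1 - w⁻¹ * r : ℂ) ≠ 0 := fun h0 => by
    have : ‖w⁻¹ * (r : ℂ)‖ = 1 := by rw [← sub_eq_zero.1 h0, norm_one]
    exact hb.ne this
  have hne₃ : (w - r : ℂ) ≠ 0 := fun h0 => hne₂ (by
    rw [show (1 : ℂ) - w⁻¹ * r = w⁻¹ * (w - r) by field_simp, h0, mul_zero])
  have hconj : conj (1 - w * (r : ℂ)) = 1 - w⁻¹ * r := by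
    rw [map_sub, map_one, map_mul, Complex.conj_ofReal, Complex.inv_eq_conj hw]
  have hnormsq : ((‖1 - w * (r : ℂ)‖ ^ 2 : ℝ) : ℂ) = (1 - w * r) * (1 - w⁻¹ * r) := by
    rw [Complex.ofReal_pow, ← hconj, Complex.mul_conj']
  have hne₁' : (1 - (r : ℂ) * w) ≠ 0 := by rwa [mul_comm] at hne₁
  have hne₂' : (1 - (r : ℂ) * w⁻¹) ≠ 0 := by rwa [mul_comm] at hne₂
  rw [Complex.ofReal_div, hnormsq]
  push_cast
  field_simp
  ring

/-- the sum `(1 − r²) ∕ |1 − w r|²` is a POSITIVE real. [cite: TateThesis1967, §4.2] -/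
theorem int_geometric_unit_pos {w : ℂ} (hw : ‖w‖ = 1) {r : ℝ} (hr0 : 0 ≤ r) (hr1 : r < 1) :
    0 < (1 - r ^ 2) / ‖1 - w * r‖ ^ 2 := by
  have ha : ‖w * (r : ℂ)‖ < 1 := by
    rw [norm_mul, hw, one_mul, Complex.norm_real, Real.norm_eq_abs, abs_of_nonneg hr0]; exact hr1
  have hne : (1 - w * r : ℂ) ≠ 0 := fun h0 => by
    have : ‖w * (r : ℂ)‖ = 1 := by rw [← sub_eq_zero.1 h0, norm_one]
    exact ha.ne this
  refine div_pos ?_ (pow_pos (norm_pos_iff.2 hne) 2)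
  nlinarith

end Geometric

/-! ## §2 Integration over a group that is a disjoint union of cosets `z₀^m K` of an open subgroup -/

section Cosets

variable {G : Type*} [Group G] [TopologicalSpace G] [IsTopologicalGroup G] [MeasurableSpace G] [BorelSpace G]

/-- **`∫_G f dμ = μ(K) · Σ_{m∈ℤ} f(z₀^m)`** for a right-`K`-invariant `f` on `G = ⊔_{m∈ℤ} z₀^m K` (`K` an open subgroup of finite measure for
the left-invariant measure `μ`, `z₀^m ∈ K ⇒ m = 0`), provided `Σ_m ‖f(z₀^m)‖ < ∞`; `f` is then integrable.  The bookkeeping of a local integral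
over `F_vˣ = ⊔_m ϖ^m 𝒪ˣ` ([TateThesis1967, §3.2]). [cite: TateThesis1967, §3.2] -/
theorem integrable_and_hasSum_integral_of_cosets (μ : Measure G) [μ.IsMulLeftInvariant] (K : Subgroup G) (hKo : IsOpen (K : Set G))
    (hKμ : μ K ≠ ⊤) (z₀ : G) (hcover : ∀ h : G, ∃ m : ℤ, (z₀ ^ m)⁻¹ * h ∈ K) (hfree : ∀ m : ℤ, z₀ ^ m ∈ K → m = 0)
    (f : G → ℂ) (hf : ∀ h : G, ∀ k ∈ K, f (h * k) = f h) (hsum : Summable fun m : ℤ => ‖f (z₀ ^ m)‖) :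
    Integrable f μ ∧ HasSum (fun m : ℤ => (μ.real K : ℂ) * f (z₀ ^ m)) (∫ h, f h ∂μ) := by
  classical
  -- the cosets `s m = z₀^m K`
  set s : ℤ → Set G := fun m => (fun h : G => (z₀ ^ m)⁻¹ * h) ⁻¹' (K : Set G) with hs
  have hsm : ∀ m, MeasurableSet (s m) := fun m => (hKo.preimage (continuous_const_mul _)).measurableSet
  have hμs : ∀ m, μ (s m) = μ K := fun m => measure_preimage_mul μ _ _
  have hconst : ∀ m, ∀ h ∈ s m, f h = f (z₀ ^ m) := by
    intro m h hh
    have e : h = z₀ ^ m * ((z₀ ^ m)⁻¹ * h) := by rw [mul_inv_cancel_left]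
    rw [e]
    exact hf _ _ hh
  have hdisj : Pairwise (Function.onFun Disjoint s) := by
    intro m m' hmm'
    refine Set.disjoint_left.2 fun h hm hm' => hmm' ?_
    have h1 : (z₀ ^ m)⁻¹ * h ∈ K := hm
    have h2 : (z₀ ^ m')⁻¹ * h ∈ K := hm'
    have h3 : (z₀ ^ m)⁻¹ * h * ((z₀ ^ m')⁻¹ * h)⁻¹ ∈ K := K.mul_mem h1 (K.inv_mem h2)
    have e : (z₀ ^ m)⁻¹ * h * ((z₀ ^ m')⁻¹ * h)⁻¹ = z₀ ^ (m' - m) := by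
      rw [mul_inv_rev, inv_inv, mul_assoc, mul_inv_cancel_left, ← zpow_neg, ← zpow_add]
      ring_nf
    rw [e] at h3
    have := hfree _ h3
    omega
  have hcov : (⋃ m, s m) = Set.univ := Set.eq_univ_of_forall fun h => Set.mem_iUnion.2 (hcover h)
  -- integrability on each coset and summability of the integrals of the norm
  have hKlt : μ K < ⊤ := lt_top_iff_ne_top.2 hKμ
  have hi : ∀ m, IntegrableOn f (s m) μ := fun m =>
    (integrableOn_const (C := f (z₀ ^ m)) (by rw [hμs]; exact hKμ)).congr_fun (fun h hh => (hconst m h hh).symm) (hsm m)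
  have hnorm : ∀ m, ∫ h in s m, ‖f h‖ ∂μ = μ.real K * ‖f (z₀ ^ m)‖ := by
    intro m
    rw [setIntegral_congr_fun (hsm m) (fun h hh => by rw [hconst m h hh]), setIntegral_const, smul_eq_mul, Measure.real, Measure.real, hμs]
  have hval : ∀ m, ∫ h in s m, f h ∂μ = (μ.real K : ℂ) * f (z₀ ^ m) := by
    intro m
    rw [setIntegral_congr_fun (hsm m) (fun h hh => hconst m h hh), setIntegral_const, Complex.real_smul, Measure.real, Measure.real, hμs]
  have hint : IntegrableOn f (⋃ m, s m) μ := by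
    refine integrableOn_iUnion_of_summable_integral_norm hi ?_
    simp_rw [hnorm]
    exact hsum.mul_left _
  have hintegrable : Integrable f μ := by
    rw [hcov] at hint
    exact integrableOn_univ.1 hint
  refine ⟨hintegrable, ?_⟩
  have h := hasSum_integral_iUnion hsm hdisj hint
  rw [hcov, Measure.restrict_univ] at h
  simp_rw [hval] at h
  exact h

end Cosets

end Literature.NumberTheory.Li1992

/-! ## §3 The local factor at a split place with unramified data, from the spherical matrix coefficients -/

namespace Literature.NumberTheory.GelbartRogawski1991.UnitaryDualPair.LocalSplitting.FinLocalSplittings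

variable {F : Type} [Field F] [NumberField F] {E : Type} [Field E] [NumberField E] [Algebra F E]
  [Algebra.IsQuadraticExtension F E] {c : E ≃ₐ[F] E} {N : ℕ} {δ : E} {hcδ : c δ = -δ} {hδ : δ ≠ 0} {d : F}
  {hd : δ * δ = algebraMap F E d} {T : Matrix (Fin N) (Fin N) F} {hT : T.IsSymm}
  {J : Matrix (Fin N) (Fin N) E} {hJ : J = T.map (algebraMap F E)}
  (𝓢 : FinLocalSplittings F E c N hcδ hδ hd T hT hJ) (J₁ : Matrix (Fin 1) (Fin 1) E) (hJ₁ : J₁ 0 0 ≠ 0)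
  (v : HeightOneSpectrum (𝓞 F))
  [MeasurableSpace (localPi E c 1 J₁ v)] [BorelSpace (localPi E c 1 J₁ v)]
  (dh : Measure (localPi E c 1 J₁ v)) [dh.IsMulLeftInvariant] [IsFiniteMeasureOnCompacts dh]
  [MeasurableSpace (Fin N → v.adicCompletion F)] (μX : Measure (Fin N → v.adicCompletion F))
  (χv : localPi E c 1 J₁ v →* ℂˣ) (z₀ : localPi E c 1 J₁ v)

/-- **THE LOCAL FACTOR OF (27) AT A SPLIT PLACE, UNRAMIFIED DATA, FROM THE SPHERICAL MATRIX COEFFICIENTS.**  At a place `v` where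
`U(J₁)(F_v) = ⊔_{m∈ℤ} z₀^m U(J₁)(𝒪_v)` (`hcover`, `hfree`: a split place, `z₀` of valuation `±1` at `w ∣ v`), if the integral torus fixes the
spherical vector `1_{𝒪_vᴺ}` through the centre (`hfix`), `χ_v` is trivial on `U(J₁)(𝒪_v)` (`hχK`) and unitary at `z₀`, and the spherical matrix
coefficients are `⟨ω_v(z₀^m · 1) 1_{𝒪ᴺ}, 1_{𝒪ᴺ}⟩ = C u^m r^{|m|}` (`|u| = 1`, `0 ≤ r < 1`), then the integrand of the local factor is integrable and
`∫_{U(J₁)(F_v)} ⟨ω_v(h·1) 1_{𝒪ᴺ}, 1_{𝒪ᴺ}⟩ conj χ_v(h) dh = dh(U(J₁)(𝒪_v)) · C · (1 − r²) ∕ |1 − u conj χ_v(z₀) r|²` (the Tate-type sum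
`vol · Σ_m C (u conj χ_v(z₀))^m r^{|m|}`). [cite: Li1992, Thm 2.1 (27) p. 184; §5 p. 206] [cite: TateThesis1967, §3.2, §4.2] -/
theorem integral_localFactor_unitVec_of_sphericalCoeff
    (hcover : ∀ h : localPi E c 1 J₁ v, ∃ m : ℤ, (z₀ ^ m)⁻¹ * h ∈ localInt E c 1 J₁ v)
    (hfree : ∀ m : ℤ, z₀ ^ m ∈ localInt E c 1 J₁ v → m = 0)
    (hfix : ∀ k ∈ localInt E c 1 J₁ v, 𝓢.omegaLoc v (localCenter E c N J J₁ hJ₁ v k) (unitVec F (Fin N) v) = unitVec F (Fin N) v)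
    (hχK : ∀ k ∈ localInt E c 1 J₁ v, χv k = 1) (hχu : ‖((χv z₀ : ℂˣ) : ℂ)‖ = 1)
    {C u : ℂ} (hu : ‖u‖ = 1) {r : ℝ} (hr0 : 0 ≤ r) (hr1 : r < 1)
    (hcoef : ∀ m : ℤ, ∫ x, ((𝓢.omegaLoc v (localCenter E c N J J₁ hJ₁ v (z₀ ^ m)) (unitVec F (Fin N) v) :
          ↥(SchwartzBruhat (Fin N → v.adicCompletion F))) : (Fin N → v.adicCompletion F) → ℂ) x *
        conj (((unitVec F (Fin N) v : ↥(SchwartzBruhat (Fin N → v.adicCompletion F))) : (Fin N → v.adicCompletion F) → ℂ) x) ∂μX =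
        C * u ^ m * (r : ℂ) ^ m.natAbs) :
    Integrable (fun h : localPi E c 1 J₁ v =>
        (∫ x, ((𝓢.omegaLoc v (localCenter E c N J J₁ hJ₁ v h) (unitVec F (Fin N) v) :
              ↥(SchwartzBruhat (Fin N → v.adicCompletion F))) : (Fin N → v.adicCompletion F) → ℂ) x *
            conj (((unitVec F (Fin N) v : ↥(SchwartzBruhat (Fin N → v.adicCompletion F))) : (Fin N → v.adicCompletion F) → ℂ) x) ∂μX) *
          conj (((χv h : ℂˣ) : ℂ))) dh ∧
      ∫ h, (∫ x, ((𝓢.omegaLoc v (localCenter E c N J J₁ hJ₁ v h) (unitVec F (Fin N) v) :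
              ↥(SchwartzBruhat (Fin N → v.adicCompletion F))) : (Fin N → v.adicCompletion F) → ℂ) x *
            conj (((unitVec F (Fin N) v : ↥(SchwartzBruhat (Fin N → v.adicCompletion F))) : (Fin N → v.adicCompletion F) → ℂ) x) ∂μX) *
          conj (((χv h : ℂˣ) : ℂ)) ∂dh =
        (dh.real (localInt E c 1 J₁ v : Set (localPi E c 1 J₁ v)) : ℂ) * C *
          (((1 - r ^ 2) / ‖1 - (u * conj ((χv z₀ : ℂˣ) : ℂ)) * r‖ ^ 2 : ℝ) : ℂ) := by
  set f : localPi E c 1 J₁ v → ℂ := fun h =>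
    (∫ x, ((𝓢.omegaLoc v (localCenter E c N J J₁ hJ₁ v h) (unitVec F (Fin N) v) :
          ↥(SchwartzBruhat (Fin N → v.adicCompletion F))) : (Fin N → v.adicCompletion F) → ℂ) x *
        conj (((unitVec F (Fin N) v : ↥(SchwartzBruhat (Fin N → v.adicCompletion F))) : (Fin N → v.adicCompletion F) → ℂ) x) ∂μX) *
      conj (((χv h : ℂˣ) : ℂ)) with hfdef
  -- right invariance under the integral torus
  have hf : ∀ h : localPi E c 1 J₁ v, ∀ k ∈ localInt E c 1 J₁ v, f (h * k) = f h := by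
    intro h k hk
    simp only [hfdef, map_mul]
    rw [show (𝓢.omegaLoc v (localCenter E c N J J₁ hJ₁ v h) * 𝓢.omegaLoc v (localCenter E c N J J₁ hJ₁ v k)) (unitVec F (Fin N) v) =
        𝓢.omegaLoc v (localCenter E c N J J₁ hJ₁ v h) (unitVec F (Fin N) v) by rw [Module.End.mul_apply, hfix k hk],
      hχK k hk, mul_one]
  -- the values on the generators: `f(z₀^m) = C (u conj χ_v(z₀))^m r^{|m|}`
  set w : ℂ := u * conj ((χv z₀ : ℂˣ) : ℂ) with hwdef
  have hw : ‖w‖ = 1 := by rw [hwdef, norm_mul, hu, Complex.norm_conj, hχu, one_mul]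
  have hfz : ∀ m : ℤ, f (z₀ ^ m) = C * (w ^ m * (r : ℂ) ^ m.natAbs) := by
    intro m
    simp only [hfdef]
    rw [hcoef m, map_zpow, Units.val_zpow_eq_zpow_val, map_zpow₀, hwdef, mul_zpow]
    ring
  have hsum : Summable fun m : ℤ => ‖f (z₀ ^ m)‖ := by
    have h := (Li1992.summable_pow_natAbs hr0 hr1).mul_left ‖C‖
    refine h.congr fun m => ?_
    rw [hfz m, norm_mul, norm_mul, norm_zpow, hw, one_zpow, one_mul, norm_pow, Complex.norm_real, Real.norm_eq_abs, abs_of_nonneg hr0]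
  obtain ⟨hint, hS⟩ := Li1992.integrable_and_hasSum_integral_of_cosets dh (localInt E c 1 J₁ v) (isOpen_localInt E c 1 J₁ v)
    (isCompact_localInt E c 1 J₁ v).measure_lt_top.ne z₀ hcover hfree f hf hsum
  refine ⟨hint, ?_⟩
  -- the Tate-type sum
  have hgeo := (Li1992.hasSum_int_geometric_unit hw hr0 hr1).mul_left ((dh.real (localInt E c 1 J₁ v : Set (localPi E c 1 J₁ v)) : ℂ) * C)
  have hS' : HasSum (fun m : ℤ => (dh.real (localInt E c 1 J₁ v : Set (localPi E c 1 J₁ v)) : ℂ) * C * (w ^ m * (r : ℂ) ^ m.natAbs))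
      (∫ h, f h ∂dh) := by
    refine hS.congr_fun fun m => ?_
    rw [hfz m, mul_assoc]
  exact hS'.unique hgeo

/-- **… and it is NON-ZERO** as soon as `C ≠ 0` (e.g. `C = μ_X(𝒪_vᴺ)`) and `U(J₁)(𝒪_v)` has positive measure: the value
`(1 − r²) ∕ |1 − u conj χ_v(z₀) r|²` is a positive real. [cite: Li1992, Thm 2.1 (27) p. 184; §5 p. 206] [cite: TateThesis1967, §4.2] -/
theorem integral_localFactor_unitVec_ne_zero_of_sphericalCoeff
    (hcover : ∀ h : localPi E c 1 J₁ v, ∃ m : ℤ, (z₀ ^ m)⁻¹ * h ∈ localInt E c 1 J₁ v)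
    (hfree : ∀ m : ℤ, z₀ ^ m ∈ localInt E c 1 J₁ v → m = 0)
    (hfix : ∀ k ∈ localInt E c 1 J₁ v, 𝓢.omegaLoc v (localCenter E c N J J₁ hJ₁ v k) (unitVec F (Fin N) v) = unitVec F (Fin N) v)
    (hχK : ∀ k ∈ localInt E c 1 J₁ v, χv k = 1) (hχu : ‖((χv z₀ : ℂˣ) : ℂ)‖ = 1)
    {C u : ℂ} (hC : C ≠ 0) (hu : ‖u‖ = 1) {r : ℝ} (hr0 : 0 ≤ r) (hr1 : r < 1)
    (hcoef : ∀ m : ℤ, ∫ x, ((𝓢.omegaLoc v (localCenter E c N J J₁ hJ₁ v (z₀ ^ m)) (unitVec F (Fin N) v) :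
          ↥(SchwartzBruhat (Fin N → v.adicCompletion F))) : (Fin N → v.adicCompletion F) → ℂ) x *
        conj (((unitVec F (Fin N) v : ↥(SchwartzBruhat (Fin N → v.adicCompletion F))) : (Fin N → v.adicCompletion F) → ℂ) x) ∂μX =
        C * u ^ m * (r : ℂ) ^ m.natAbs)
    (hK : dh (localInt E c 1 J₁ v : Set (localPi E c 1 J₁ v)) ≠ 0) :
    ∫ h, (∫ x, ((𝓢.omegaLoc v (localCenter E c N J J₁ hJ₁ v h) (unitVec F (Fin N) v) :
            ↥(SchwartzBruhat (Fin N → v.adicCompletion F))) : (Fin N → v.adicCompletion F) → ℂ) x *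
          conj (((unitVec F (Fin N) v : ↥(SchwartzBruhat (Fin N → v.adicCompletion F))) : (Fin N → v.adicCompletion F) → ℂ) x) ∂μX) *
        conj (((χv h : ℂˣ) : ℂ)) ∂dh ≠ 0 := by
  rw [(𝓢.integral_localFactor_unitVec_of_sphericalCoeff J₁ hJ₁ v dh μX χv z₀ hcover hfree hfix hχK hχu hu hr0 hr1 hcoef).2]
  have hw : ‖u * conj ((χv z₀ : ℂˣ) : ℂ)‖ = 1 := by rw [norm_mul, hu, Complex.norm_conj, hχu, one_mul]
  refine mul_ne_zero (mul_ne_zero ?_ hC) ?_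
  · have hreal : 0 < dh.real (localInt E c 1 J₁ v : Set (localPi E c 1 J₁ v)) :=
      ENNReal.toReal_pos hK (isCompact_localInt E c 1 J₁ v).measure_lt_top.ne
    exact_mod_cast hreal.ne'
  · exact_mod_cast (Li1992.int_geometric_unit_pos hw hr0 hr1).ne'

end Literature.NumberTheory.GelbartRogawski1991.UnitaryDualPair.LocalSplitting.FinLocalSplittings

end
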